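import Literature.NumberTheory.LFunctions.MoebiusWalshTypeIIZero
import HarnessLib

/-!
# The type-II box estimate with the unshifted digit window (`K = 0`), closed form
# (Bourgain 2013, §2, (2.19)–(2.22))

Topic `Literature/NumberTheory/LFunctions`; proofs-only (theorems, no definition, no named fact).
This file finishes the `K = 0` half of the TYPE-II estimate of J. Bourgain, *Möbius–Walsh
correlation bounds and an estimate of Mauduit and Rivat*, J. Anal. Math. **119** (2013) 147–163
(= arXiv:1109.2784) [Bourgain2013MoebiusWalsh], §2, for the dyadic box sums of the tree's Vaughan
reduction (`MoebiusWalshVaughan.boxSum T i j α β = ∑_{a ∈ D_i} ∑_{b ∈ D_j} α(a) β(b) w_T(ab)`,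
`D_i = [2^i, 2^{i+1})`, `|α|, |β| ≤ 1`, short side `i ≤ j`).

`MoebiusWalshTypeIIZero.boxSum_sq_typeII_zero_le` (tree) states the estimate SQUARED with the
resonance count left in the closed form of `typeII_core_zero`: a double sum over the lag
`1 ≤ h < L = 2^ρ` and the `2`-adic valuation `r` of the frequency difference, of
`(N + 2^{q-r}) [(1 + log 2^q) P(0)P(r) + 2 min(η² 2^{q-u} 2^{q-r}, P(u)P(r)) (2M/2^{q-r} + 2^u(1 + log 2^u))]`,
`u = r - v₂(h)`, `q = i + ρ + 1 + t`, `η = 2·2^{-c₂|T ∩ [0,q)|}` (Lemma 2), `P(m) = 2·2^{κ(q-m)}`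
(Lemma 4), `c₂ = walshSupExponent`, `κ = walshL1Exponent`. Here we choose the switch point of the
`min` — Bourgain's (2.20)/(2.21), "`ML2^{-r} ≷ L^C`", with `C = 50`: the progression branch for
`r ≤ i - 50ρ`, the sup branch above — and sum everything, obtaining the printed shape (2.22)
"`X²(L^{-1} + L^C 2^{-c|S'|})`" together with the generic term (2.15) "`X² L N^{-c}`" (here
absorbed into `L^{-1}` using `M ≥ L^{50}`) and the carry error `X² 2^{-t}`:

* `zero_summand_le` — every summand of the double sum is
  `≤ 2^i N (2 + log 2^q) (32/2^ρ + 48/2^{⌊ρ/2⌋} + 4·2^{54ρ+3t} η²)` (`t ≤ ρ`, `50ρ ≤ i`, `2^i ≤ N`);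
* `boxSum_sq_typeII_zero_bound` — for `t ≤ ρ`, `50ρ ≤ i ≤ j`, `|α|, |β| ≤ 1`:
  `(boxSum T i j α β)² ≤ 4^{i+j} (q+1)² (324/2^{⌊ρ/2⌋} + 24/2^t + 48·2^ρ/2^j + 32·2^{54ρ+3t} η²)`;
* `abs_boxSum_typeII_zero_bound` — the same after the square root, against any majorant.

Only the numerical value `κ ≤ 9/20` of the exponent of Lemmas 3–4 enters
(`walshL1Exponent_le`: `(2 + √2)^5 ≤ 2^9`); all losses `L^{O(1)}`, `q^{O(1)}` are kept explicit and
no attempt is made to optimise `C = 50` or the constants. The shifted windows `K ≥ μ - ρ`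
((2.23)–(2.27)) are not treated here (see `MoebiusWalshTypeIIHigh.lean`).

## References

* J. Bourgain, J. Anal. Math. 119 (2013) 147–163, §2, (2.13)–(2.22). [Bourgain2013MoebiusWalsh]
-/

noncomputable section

open Finset Real

namespace Literature.NumberTheory.LFunctions.MoebiusWalshTypeII

open Literature.NumberTheory.LFunctions.MoebiusWalshVaughan (natWalsh dyBlock boxSum)
open Literature.NumberTheory.LFunctions.MoebiusWalsh (walshSupExponent walshL1Exponent
  walshL1Exponent_pos walshL1Exponent_lt_half)

/-! ### Numerical value of the `ℓ¹` exponent -/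

/-- `κ = log₂(2 + √2)/4 ≤ 9/20`, i.e. `(2 + √2)^5 ≤ 2^9 = 512` (`(2+√2)^5 = 232 + 164√2`).
[folklore] -/
theorem walshL1Exponent_le : walshL1Exponent ≤ 9 / 20 := by
  unfold walshL1Exponent
  set s := Real.sqrt 2 with hs
  have hs0 : 0 ≤ s := Real.sqrt_nonneg 2
  have hs2 : s ^ 2 = 2 := Real.sq_sqrt (by norm_num)
  have hslt : s < 3 / 2 := by
    rw [hs, Real.sqrt_lt' (by norm_num)]; norm_num
  have h5 : (2 + s) ^ 5 = 232 + 164 * s := by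
    linear_combination (s ^ 3 + 10 * s ^ 2 + 42 * s + 100) * hs2
  have hpow : (2 + s) ^ 5 ≤ (2 : ℝ) ^ (9 : ℕ) := by rw [h5]; norm_num; nlinarith
  -- `2 + s ≤ 2^{9/5}`
  have hle : 2 + s ≤ (2 : ℝ) ^ ((9 : ℝ) / 5) := by
    have h1 : 2 + s = ((2 + s) ^ 5) ^ ((5 : ℕ) : ℝ)⁻¹ :=
      (Real.pow_rpow_inv_natCast (by positivity) (by norm_num)).symm
    have h2 : (2 : ℝ) ^ ((9 : ℝ) / 5) = ((2 : ℝ) ^ (9 : ℕ)) ^ ((5 : ℕ) : ℝ)⁻¹ := by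
      rw [← Real.rpow_natCast 2 9, ← Real.rpow_mul (by norm_num)]
      norm_num
    rw [h1, h2]
    exact Real.rpow_le_rpow (by positivity) hpow (by positivity)
  have hlog : Real.logb 2 (2 + s) ≤ 9 / 5 := by
    rw [Real.logb_le_iff_le_rpow one_lt_two (by positivity)]
    exact hle
  linarith

/-! ### Small `rpow` helpers (base `2`) -/

/-- Monotonicity of `2^x`. [folklore] -/
theorem two_rpow_le_two_rpow {x y : ℝ} (h : x ≤ y) : (2 : ℝ) ^ x ≤ (2 : ℝ) ^ y :=
  Real.rpow_le_rpow_of_exponent_le one_le_two h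

/-- `2^n = 2^(n : ℝ)`. [folklore] -/
theorem two_pow_eq_rpow (n : ℕ) : (2 : ℝ) ^ n = (2 : ℝ) ^ (n : ℝ) := (Real.rpow_natCast 2 n).symm

/-- `2^x 2^y = 2^(x+y)`. [folklore] -/
theorem two_rpow_mul_two_rpow (x y : ℝ) : (2 : ℝ) ^ x * (2 : ℝ) ^ y = (2 : ℝ) ^ (x + y) :=
  (Real.rpow_add two_pos x y).symm

/-- `2^2 = 4` (`rpow`). [folklore] -/
theorem two_rpow_two : (2 : ℝ) ^ (2 : ℝ) = 4 := by norm_num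

/-- `2^3 = 8` (`rpow`). [folklore] -/
theorem two_rpow_three : (2 : ℝ) ^ (3 : ℝ) = 8 := by norm_num

/-- `2^{-cρ} ≤ 1/2^{⌊ρ/2⌋}` for `c ≥ 1/2`. [folklore] -/
theorem two_rpow_neg_le_inv_pow_half (ρ : ℕ) {c : ℝ} (hc : 1 / 2 ≤ c) :
    (2 : ℝ) ^ (-(c * ρ)) ≤ 1 / 2 ^ (ρ / 2) := by
  have h1 : ((ρ / 2 : ℕ) : ℝ) ≤ (ρ : ℝ) / 2 := Nat.cast_div_le
  have h2 : (ρ : ℝ) / 2 ≤ c * ρ := by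
    have := Nat.cast_nonneg (α := ℝ) ρ
    nlinarith
  rw [one_div, two_pow_eq_rpow, ← Real.rpow_neg (by norm_num)]
  exact two_rpow_le_two_rpow (by linarith)

/-! ### One summand of the resonance sum -/

/-- **One summand of the `K = 0` resonance sum, with the switch (2.20)/(2.21) at
`2^r = M L^{-50}`.** For `q = i + ρ + 1 + t`, `r < q`, `s < ρ` (`s = v₂(h)`), `t ≤ ρ`,
`50ρ ≤ i`, `2^i ≤ N`, the summand
`(N + 2^{q-r}) [(1 + log 2^q) P(0)P(r) + 2 min(η² 2^{q-u} 2^{q-r}, P(u)P(r)) (2·2^i/2^{q-r} + 2^u(1 + log 2^u))]`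
(`u = r - s`, `P(m) = 2·2^{κ(q-m)}`) is at most
`2^i N (2 + log 2^q) (32/2^ρ + 48/2^{⌊ρ/2⌋} + 4·2^{54ρ+3t} η²)`: for `r ≤ i - 50ρ` the
progression branch of the `min` is used (Lemma 4 twice, (2.18)–(2.20)), above it the sup branch
((2.21)); the generic term `(1 + log 2^q)P(0)P(r)` is (2.15).
[cite: Bourgain2013MoebiusWalsh, §2 (2.15), (2.18)–(2.22)] -/
theorem zero_summand_le {q r s i ρ t : ℕ} (hq : q = i + ρ + 1 + t) (hr : r < q) (hs : s < ρ)
    (htρ : t ≤ ρ) (hρi : 50 * ρ ≤ i) {N : ℝ} (hNM : (2 : ℝ) ^ i ≤ N) (η : ℝ) :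
    (N + 2 ^ (q - r)) *
        ((1 + Real.log ((2 : ℝ) ^ q)) *
            ((2 * (2 : ℝ) ^ (walshL1Exponent * ((q - 0 : ℕ) : ℝ))) *
              (2 * (2 : ℝ) ^ (walshL1Exponent * ((q - r : ℕ) : ℝ)))) +
          2 * (min (η ^ 2 * 2 ^ (q - (r - s)) * 2 ^ (q - r))
                  ((2 * (2 : ℝ) ^ (walshL1Exponent * ((q - (r - s) : ℕ) : ℝ))) *
                    (2 * (2 : ℝ) ^ (walshL1Exponent * ((q - r : ℕ) : ℝ)))) *
            (2 * ((2 : ℝ) ^ i / 2 ^ (q - r)) + 2 ^ (r - s) * (1 + Real.log ((2 : ℝ) ^ (r - s)))))) ≤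
      2 ^ i * N * (2 + Real.log ((2 : ℝ) ^ q)) *
        (32 / 2 ^ ρ + 48 / 2 ^ (ρ / 2) + 4 * 2 ^ (54 * ρ + 3 * t) * η ^ 2) := by
  -- names
  set κ := walshL1Exponent with hκdef
  have hκ0 : 0 ≤ κ := walshL1Exponent_pos.le
  have hκ : κ ≤ 9 / 20 := walshL1Exponent_le
  set M : ℝ := (2 : ℝ) ^ i with hM
  have hM0 : 0 < M := by positivity
  have hN0 : 0 < N := lt_of_lt_of_le hM0 hNM
  set lg : ℝ := 1 + Real.log ((2 : ℝ) ^ q) with hlg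
  have hlogq0 : 0 ≤ Real.log ((2 : ℝ) ^ q) := Real.log_nonneg (one_le_pow₀ one_le_two)
  have hlg1 : 1 ≤ lg := by rw [hlg]; linarith
  have hlg0 : 0 ≤ lg := by linarith
  -- casts of the natural-number data
  have hrq : r ≤ q := hr.le
  have hρi' : (50 : ℝ) * ρ ≤ i := by exact_mod_cast hρi
  have htρ' : (t : ℝ) ≤ ρ := by exact_mod_cast htρ
  have hs' : (s : ℝ) + 1 ≤ ρ := by exact_mod_cast hs
  have hr' : (r : ℝ) ≤ q := by exact_mod_cast hrq
  have hr0 : (0 : ℝ) ≤ r := Nat.cast_nonneg r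
  have hs0 : (0 : ℝ) ≤ s := Nat.cast_nonneg s
  have hqR : (q : ℝ) = i + ρ + 1 + t := by rw [hq]; push_cast; ring
  have hqr : ((q - r : ℕ) : ℝ) = (q : ℝ) - r := by rw [Nat.cast_sub hrq]
  have hq0 : ((q - 0 : ℕ) : ℝ) = (q : ℝ) := by simp
  have hu : ((q - (r - s) : ℕ) : ℝ) ≤ (q : ℝ) - r + s := by
    have h1 : q - (r - s) ≤ q - r + s := by omega
    have h2 : ((q - (r - s) : ℕ) : ℝ) ≤ ((q - r + s : ℕ) : ℝ) := by exact_mod_cast h1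
    rw [Nat.cast_add, Nat.cast_sub hrq] at h2
    linarith
  -- powers as `rpow`
  have hQr : (2 : ℝ) ^ (q - r) = (2 : ℝ) ^ ((q : ℝ) - r) := by
    rw [two_pow_eq_rpow, Nat.cast_sub hrq]
  have hQu : (2 : ℝ) ^ (q - (r - s)) ≤ (2 : ℝ) ^ ((q : ℝ) - r + s) := by
    rw [two_pow_eq_rpow]; exact two_rpow_le_two_rpow hu
  have h2rs : (2 : ℝ) ^ (r - s) ≤ (2 : ℝ) ^ (r : ℝ) := by
    rw [two_pow_eq_rpow]
    exact two_rpow_le_two_rpow (by exact_mod_cast Nat.sub_le r s)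
  -- the last factor `F ≤ 2^r (1 + lg)`
  have hF : 2 * ((2 : ℝ) ^ i / 2 ^ (q - r)) + 2 ^ (r - s) * (1 + Real.log ((2 : ℝ) ^ (r - s))) ≤
      (2 : ℝ) ^ (r : ℝ) * (1 + lg) := by
    have h1 : 2 * ((2 : ℝ) ^ i / 2 ^ (q - r)) ≤ (2 : ℝ) ^ (r : ℝ) := by
      rw [hQr, two_pow_eq_rpow, ← Real.rpow_sub two_pos,
        show (2 : ℝ) * (2 : ℝ) ^ ((i : ℝ) - ((q : ℝ) - r)) =
          (2 : ℝ) ^ (1 : ℝ) * (2 : ℝ) ^ ((i : ℝ) - ((q : ℝ) - r)) by rw [Real.rpow_one],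
        two_rpow_mul_two_rpow]
      exact two_rpow_le_two_rpow (by rw [hqR]; linarith)
    have h2 : (2 : ℝ) ^ (r - s) * (1 + Real.log ((2 : ℝ) ^ (r - s))) ≤ (2 : ℝ) ^ (r : ℝ) * lg := by
      have hl : Real.log ((2 : ℝ) ^ (r - s)) ≤ Real.log ((2 : ℝ) ^ q) :=
        Real.log_le_log (by positivity) (pow_le_pow_right₀ one_le_two (by omega))
      have hl0 : 0 ≤ Real.log ((2 : ℝ) ^ (r - s)) := Real.log_nonneg (one_le_pow₀ one_le_two)
      exact mul_le_mul h2rs (by rw [hlg]; linarith) (by linarith) (by positivity)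
    calc _ ≤ (2 : ℝ) ^ (r : ℝ) + (2 : ℝ) ^ (r : ℝ) * lg := add_le_add h1 h2
      _ = (2 : ℝ) ^ (r : ℝ) * (1 + lg) := by ring
  have hF0 : 0 ≤ 2 * ((2 : ℝ) ^ i / 2 ^ (q - r)) + 2 ^ (r - s) * (1 + Real.log ((2 : ℝ) ^ (r - s))) := by
    have : 0 ≤ Real.log ((2 : ℝ) ^ (r - s)) := Real.log_nonneg (one_le_pow₀ one_le_two)
    positivity
  -- `N + 2^{q-r} ≤ N 2^{ρ+t+2}`
  have hNQ : N + (2 : ℝ) ^ (q - r) ≤ N * (2 : ℝ) ^ ((ρ : ℝ) + t + 2) := by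
    have h1 : (2 : ℝ) ^ (q - r) ≤ N * (2 : ℝ) ^ ((ρ : ℝ) + t + 1) := by
      rw [hQr]
      calc (2 : ℝ) ^ ((q : ℝ) - r) ≤ (2 : ℝ) ^ ((i : ℝ) + ((ρ : ℝ) + t + 1)) :=
            two_rpow_le_two_rpow (by rw [hqR]; linarith)
        _ = M * (2 : ℝ) ^ ((ρ : ℝ) + t + 1) := by rw [Real.rpow_add two_pos, ← two_pow_eq_rpow i, ← hM]
        _ ≤ N * (2 : ℝ) ^ ((ρ : ℝ) + t + 1) := by gcongr
    have h2 : (2 : ℝ) ^ ((ρ : ℝ) + t + 2) = 2 * (2 : ℝ) ^ ((ρ : ℝ) + t + 1) := by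
      rw [show (ρ : ℝ) + t + 2 = 1 + ((ρ : ℝ) + t + 1) by ring, ← two_rpow_mul_two_rpow, Real.rpow_one]
    have h3 : N ≤ N * (2 : ℝ) ^ ((ρ : ℝ) + t + 1) := by
      have : (1 : ℝ) ≤ (2 : ℝ) ^ ((ρ : ℝ) + t + 1) := Real.one_le_rpow one_le_two (by positivity)
      nlinarith
    rw [h2]; linarith
  have hNQ0 : 0 ≤ N + (2 : ℝ) ^ (q - r) := by positivity
  -- ### part 1: the generic term (2.15)
  set P0 : ℝ := 2 * (2 : ℝ) ^ (κ * ((q - 0 : ℕ) : ℝ)) with hP0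
  set Pr : ℝ := 2 * (2 : ℝ) ^ (κ * ((q - r : ℕ) : ℝ)) with hPr
  have hP0Pr : P0 * Pr ≤ 4 * (2 : ℝ) ^ ((9 : ℝ) / 10 * q) := by
    have h1 : (2 : ℝ) ^ (κ * ((q - 0 : ℕ) : ℝ)) ≤ (2 : ℝ) ^ ((9 : ℝ) / 20 * q) := by
      rw [hq0]; exact two_rpow_le_two_rpow (mul_le_mul_of_nonneg_right hκ (Nat.cast_nonneg q))
    have h2 : (2 : ℝ) ^ (κ * ((q - r : ℕ) : ℝ)) ≤ (2 : ℝ) ^ ((9 : ℝ) / 20 * q) := by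
      refine two_rpow_le_two_rpow ?_
      rw [hqr]
      have : κ * ((q : ℝ) - r) ≤ κ * q := mul_le_mul_of_nonneg_left (by linarith) hκ0
      exact this.trans (mul_le_mul_of_nonneg_right hκ (Nat.cast_nonneg q))
    calc P0 * Pr ≤ (2 * (2 : ℝ) ^ ((9 : ℝ) / 20 * q)) * (2 * (2 : ℝ) ^ ((9 : ℝ) / 20 * q)) := by
          rw [hP0, hPr]; gcongr
      _ = 4 * ((2 : ℝ) ^ ((9 : ℝ) / 20 * q) * (2 : ℝ) ^ ((9 : ℝ) / 20 * q)) := by ring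
      _ = 4 * (2 : ℝ) ^ ((9 : ℝ) / 10 * q) := by rw [two_rpow_mul_two_rpow]; ring_nf
  have hpart1 : (N + (2 : ℝ) ^ (q - r)) * (lg * (P0 * Pr)) ≤ M * N * lg * (32 / 2 ^ ρ) := by
    have h1 : (N + (2 : ℝ) ^ (q - r)) * (P0 * Pr) ≤ M * N * (32 / 2 ^ ρ) := by
      calc (N + (2 : ℝ) ^ (q - r)) * (P0 * Pr)
          ≤ (N * (2 : ℝ) ^ ((ρ : ℝ) + t + 2)) * (4 * (2 : ℝ) ^ ((9 : ℝ) / 10 * q)) :=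
            mul_le_mul hNQ hP0Pr (by rw [hP0, hPr]; positivity) (by positivity)
        _ = 4 * N * ((2 : ℝ) ^ ((ρ : ℝ) + t + 2) * (2 : ℝ) ^ ((9 : ℝ) / 10 * q)) := by ring
        _ = 4 * N * (2 : ℝ) ^ ((ρ : ℝ) + t + 2 + (9 : ℝ) / 10 * q) := by
            rw [two_rpow_mul_two_rpow]
        _ ≤ 4 * N * (2 : ℝ) ^ ((i : ℝ) + (3 - ρ)) := by
            gcongr 4 * N * ?_
            exact two_rpow_le_two_rpow (by rw [hqR]; linarith only [htρ', hρi'])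
        _ = M * N * (4 * (2 : ℝ) ^ ((3 : ℝ) - ρ)) := by
            rw [Real.rpow_add two_pos, ← two_pow_eq_rpow i, ← hM]; ring
        _ = M * N * (32 / 2 ^ ρ) := by
            rw [Real.rpow_sub two_pos, ← two_pow_eq_rpow ρ, two_rpow_three]; ring
    calc (N + (2 : ℝ) ^ (q - r)) * (lg * (P0 * Pr)) = lg * ((N + (2 : ℝ) ^ (q - r)) * (P0 * Pr)) := by
          ring
      _ ≤ lg * (M * N * (32 / 2 ^ ρ)) := mul_le_mul_of_nonneg_left h1 hlg0
      _ = M * N * lg * (32 / 2 ^ ρ) := by ring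
  -- ### parts 2/3: the resonant term, by cases on `r`
  set X : ℝ := η ^ 2 * 2 ^ (q - (r - s)) * 2 ^ (q - r) with hX
  set Y : ℝ := (2 * (2 : ℝ) ^ (κ * ((q - (r - s) : ℕ) : ℝ))) *
    (2 * (2 : ℝ) ^ (κ * ((q - r : ℕ) : ℝ))) with hY
  have hX0 : 0 ≤ X := by rw [hX]; positivity
  have hY0 : 0 ≤ Y := by rw [hY]; positivity
  have hmin0 : 0 ≤ min X Y := le_min hX0 hY0
  have hkey : (N + (2 : ℝ) ^ (q - r)) * min X Y * (2 : ℝ) ^ (r : ℝ) ≤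
      M * N * (24 / 2 ^ (ρ / 2) + 2 * 2 ^ (54 * ρ + 3 * t) * η ^ 2) := by
    have hhalf : (2 : ℝ) ^ (-((3 : ℝ) / 4 * ρ)) ≤ 1 / 2 ^ (ρ / 2) :=
      two_rpow_neg_le_inv_pow_half ρ (by norm_num)
    have hT1 : 0 ≤ M * N * (24 / 2 ^ (ρ / 2)) := by positivity
    have hT2 : 0 ≤ M * N * (2 * 2 ^ (54 * ρ + 3 * t) * η ^ 2) := by positivity
    rcases Nat.lt_or_ge (i - 50 * ρ) r with hlt | hle
    · -- sup branch: `min ≤ X`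
      have hrR : (i : ℝ) - 50 * ρ + 1 ≤ r := by
        have h1 : i - 50 * ρ + 1 ≤ r := hlt
        have : ((i - 50 * ρ + 1 : ℕ) : ℝ) ≤ ((r : ℕ) : ℝ) := by exact_mod_cast h1
        rw [Nat.cast_add, Nat.cast_sub hρi] at this; push_cast at this; linarith
      have hN50 : (2 : ℝ) ^ ((50 : ℝ) * ρ) ≤ N := by
        calc (2 : ℝ) ^ ((50 : ℝ) * ρ) ≤ (2 : ℝ) ^ (i : ℝ) := two_rpow_le_two_rpow hρi'
          _ = M := by rw [hM, two_pow_eq_rpow]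
          _ ≤ N := hNM
      -- `X 2^r ≤ η² 2^{2q - r + s}`
      have hX2 : X * (2 : ℝ) ^ (r : ℝ) ≤ η ^ 2 * (2 : ℝ) ^ (2 * (q : ℝ) - r + s) := by
        rw [hX, hQr]
        calc η ^ 2 * (2 : ℝ) ^ (q - (r - s)) * (2 : ℝ) ^ ((q : ℝ) - r) * (2 : ℝ) ^ (r : ℝ)
            ≤ η ^ 2 * (2 : ℝ) ^ ((q : ℝ) - r + s) * (2 : ℝ) ^ ((q : ℝ) - r) * (2 : ℝ) ^ (r : ℝ) := by
              gcongr
          _ = η ^ 2 * ((2 : ℝ) ^ ((q : ℝ) - r + s) * (2 : ℝ) ^ ((q : ℝ) - r) * (2 : ℝ) ^ (r : ℝ)) := by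
              ring
          _ = η ^ 2 * (2 : ℝ) ^ (2 * (q : ℝ) - r + s) := by
              rw [two_rpow_mul_two_rpow, two_rpow_mul_two_rpow]; ring_nf
      have e1 : 2 * (q : ℝ) - r + s ≤ (i : ℝ) + ((54 : ℕ) * ρ + (3 : ℕ) * t : ℕ) := by
        push_cast; rw [hqR]; linarith
      have e2 : ((q : ℝ) - r) + (2 * (q : ℝ) - r + s) ≤ (50 : ℝ) * ρ + i + ((54 : ℕ) * ρ + (3 : ℕ) * t : ℕ) := by
        push_cast; rw [hqR]; linarith
      have hA : N * (η ^ 2 * (2 : ℝ) ^ (2 * (q : ℝ) - r + s)) ≤ N * (M * (2 : ℝ) ^ (54 * ρ + 3 * t)) * η ^ 2 := by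
        have : (2 : ℝ) ^ (2 * (q : ℝ) - r + s) ≤ M * (2 : ℝ) ^ (54 * ρ + 3 * t) := by
          calc (2 : ℝ) ^ (2 * (q : ℝ) - r + s) ≤ (2 : ℝ) ^ ((i : ℝ) + ((54 : ℕ) * ρ + (3 : ℕ) * t : ℕ)) :=
                two_rpow_le_two_rpow e1
            _ = M * (2 : ℝ) ^ (54 * ρ + 3 * t) := by
                rw [Real.rpow_add two_pos, ← two_pow_eq_rpow i, ← hM, ← two_pow_eq_rpow]
        have hη2 : 0 ≤ η ^ 2 := sq_nonneg η
        calc N * (η ^ 2 * (2 : ℝ) ^ (2 * (q : ℝ) - r + s)) = N * (2 : ℝ) ^ (2 * (q : ℝ) - r + s) * η ^ 2 := by ring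
          _ ≤ N * (M * (2 : ℝ) ^ (54 * ρ + 3 * t)) * η ^ 2 := by gcongr
      have hB : (2 : ℝ) ^ ((q : ℝ) - r) * (η ^ 2 * (2 : ℝ) ^ (2 * (q : ℝ) - r + s)) ≤
          N * (M * (2 : ℝ) ^ (54 * ρ + 3 * t)) * η ^ 2 := by
        have : (2 : ℝ) ^ ((q : ℝ) - r) * (2 : ℝ) ^ (2 * (q : ℝ) - r + s) ≤ N * (M * (2 : ℝ) ^ (54 * ρ + 3 * t)) := by
          rw [two_rpow_mul_two_rpow]
          calc (2 : ℝ) ^ ((q : ℝ) - r + (2 * (q : ℝ) - r + s))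
              ≤ (2 : ℝ) ^ ((50 : ℝ) * ρ + i + ((54 : ℕ) * ρ + (3 : ℕ) * t : ℕ)) := two_rpow_le_two_rpow e2
            _ = (2 : ℝ) ^ ((50 : ℝ) * ρ) * (M * (2 : ℝ) ^ (54 * ρ + 3 * t)) := by
                rw [Real.rpow_add two_pos, Real.rpow_add two_pos, ← two_pow_eq_rpow i, ← hM,
                  ← two_pow_eq_rpow (54 * ρ + 3 * t)]
                ring
            _ ≤ N * (M * (2 : ℝ) ^ (54 * ρ + 3 * t)) := by gcongr
        have hη2 : 0 ≤ η ^ 2 := sq_nonneg η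
        calc (2 : ℝ) ^ ((q : ℝ) - r) * (η ^ 2 * (2 : ℝ) ^ (2 * (q : ℝ) - r + s))
            = (2 : ℝ) ^ ((q : ℝ) - r) * (2 : ℝ) ^ (2 * (q : ℝ) - r + s) * η ^ 2 := by ring
          _ ≤ N * (M * (2 : ℝ) ^ (54 * ρ + 3 * t)) * η ^ 2 := by gcongr
      calc (N + (2 : ℝ) ^ (q - r)) * min X Y * (2 : ℝ) ^ (r : ℝ)
          ≤ (N + (2 : ℝ) ^ (q - r)) * X * (2 : ℝ) ^ (r : ℝ) := by
            gcongr; exact min_le_left _ _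
        _ = (N + (2 : ℝ) ^ (q - r)) * (X * (2 : ℝ) ^ (r : ℝ)) := by ring
        _ ≤ (N + (2 : ℝ) ^ (q - r)) * (η ^ 2 * (2 : ℝ) ^ (2 * (q : ℝ) - r + s)) :=
            mul_le_mul_of_nonneg_left hX2 hNQ0
        _ = N * (η ^ 2 * (2 : ℝ) ^ (2 * (q : ℝ) - r + s)) +
              (2 : ℝ) ^ ((q : ℝ) - r) * (η ^ 2 * (2 : ℝ) ^ (2 * (q : ℝ) - r + s)) := by rw [hQr]; ring
        _ ≤ N * (M * (2 : ℝ) ^ (54 * ρ + 3 * t)) * η ^ 2 + N * (M * (2 : ℝ) ^ (54 * ρ + 3 * t)) * η ^ 2 :=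
            add_le_add hA hB
        _ = M * N * (2 * 2 ^ (54 * ρ + 3 * t) * η ^ 2) := by ring
        _ ≤ M * N * (24 / 2 ^ (ρ / 2) + 2 * 2 ^ (54 * ρ + 3 * t) * η ^ 2) := by
            gcongr; exact le_add_of_nonneg_left (by positivity)
    · -- progression branch: `min ≤ Y`
      have hrR : (r : ℝ) ≤ (i : ℝ) - 50 * ρ := by
        have : ((r : ℕ) : ℝ) ≤ ((i - 50 * ρ : ℕ) : ℝ) := by exact_mod_cast hle
        rw [Nat.cast_sub hρi] at this; push_cast at this; exact this
      have hYle : Y ≤ 4 * (2 : ℝ) ^ (κ * (2 * q - 2 * r + ρ)) := by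
        have hu' : ((q - (r - s) : ℕ) : ℝ) ≤ (q : ℝ) - r + ρ := by linarith
        have h1 : (2 : ℝ) ^ (κ * ((q - (r - s) : ℕ) : ℝ)) ≤ (2 : ℝ) ^ (κ * ((q : ℝ) - r + ρ)) :=
          two_rpow_le_two_rpow (mul_le_mul_of_nonneg_left hu' hκ0)
        calc Y ≤ (2 * (2 : ℝ) ^ (κ * ((q : ℝ) - r + ρ))) * (2 * (2 : ℝ) ^ (κ * ((q - r : ℕ) : ℝ))) := by
              rw [hY]; gcongr
          _ = 4 * ((2 : ℝ) ^ (κ * ((q : ℝ) - r + ρ)) * (2 : ℝ) ^ (κ * ((q - r : ℕ) : ℝ))) := by ring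
          _ = 4 * (2 : ℝ) ^ (κ * (2 * q - 2 * r + ρ)) := by
              rw [two_rpow_mul_two_rpow, hqr]; ring_nf
      -- exponent bookkeeping
      have h12 : 0 ≤ 1 - 2 * κ := by linarith
      have eA : κ * (2 * q - 2 * r + ρ) + r ≤ (i : ℝ) + (1 - (3 : ℝ) / 4 * ρ) := by
        have e1 : κ * (2 * q - 2 * r + ρ) + r = κ * (2 * q + ρ) + (1 - 2 * κ) * r := by ring
        have e2 : (1 - 2 * κ) * r ≤ (1 - 2 * κ) * ((i : ℝ) - 50 * ρ) :=
          mul_le_mul_of_nonneg_left hrR h12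
        have e3 : κ * (2 * q + ρ) + (1 - 2 * κ) * ((i : ℝ) - 50 * ρ) =
            κ * (103 * ρ + 2 + 2 * t) + (i - 50 * ρ) := by rw [hqR]; ring
        have e4 : κ * (103 * ρ + 2 + 2 * t) ≤ 9 / 20 * (103 * ρ + 2 + 2 * t) :=
          mul_le_mul_of_nonneg_right hκ (by positivity)
        linarith only [e1, e2, e3, e4, htρ', hρi', hκ0]
      have eB : ((q : ℝ) - r) + κ * (2 * q - 2 * r + ρ) + r ≤ (i : ℝ) + i + (2 - (3 : ℝ) / 4 * ρ) := by
        have hX1 : κ * (2 * q - 2 * r + ρ) ≤ κ * (2 * q + ρ) :=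
          mul_le_mul_of_nonneg_left (by linarith) hκ0
        have e3 : (q : ℝ) + κ * (2 * q + ρ) - 2 * i =
            κ * (2 * i + 3 * ρ + 2 * t + 2) + (ρ + t + 1 - i) := by rw [hqR]; ring
        have e4 : κ * (2 * i + 3 * ρ + 2 * t + 2) ≤ 9 / 20 * (2 * i + 3 * ρ + 2 * t + 2) :=
          mul_le_mul_of_nonneg_right hκ (by positivity)
        linarith only [hX1, e3, e4, htρ', hρi', hr0]
      have hA : N * (2 : ℝ) ^ (κ * (2 * q - 2 * r + ρ)) * (2 : ℝ) ^ (r : ℝ) ≤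
          N * (M * (2 * (2 : ℝ) ^ (-((3 : ℝ) / 4 * ρ)))) := by
        rw [mul_assoc, two_rpow_mul_two_rpow]
        refine mul_le_mul_of_nonneg_left ?_ hN0.le
        calc (2 : ℝ) ^ (κ * (2 * q - 2 * r + ρ) + r) ≤ (2 : ℝ) ^ ((i : ℝ) + (1 - (3 : ℝ) / 4 * ρ)) :=
              two_rpow_le_two_rpow eA
          _ = M * (2 * (2 : ℝ) ^ (-((3 : ℝ) / 4 * ρ))) := by
              rw [Real.rpow_add two_pos, ← two_pow_eq_rpow i, ← hM, sub_eq_add_neg,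
                Real.rpow_add two_pos, Real.rpow_one]
      have hB : (2 : ℝ) ^ (q - r) * (2 : ℝ) ^ (κ * (2 * q - 2 * r + ρ)) * (2 : ℝ) ^ (r : ℝ) ≤
          N * (M * (4 * (2 : ℝ) ^ (-((3 : ℝ) / 4 * ρ)))) := by
        rw [hQr, two_rpow_mul_two_rpow, two_rpow_mul_two_rpow]
        calc (2 : ℝ) ^ ((q : ℝ) - r + κ * (2 * q - 2 * r + ρ) + r)
            ≤ (2 : ℝ) ^ ((i : ℝ) + i + (2 - (3 : ℝ) / 4 * ρ)) := two_rpow_le_two_rpow eB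
          _ = M * (M * (4 * (2 : ℝ) ^ (-((3 : ℝ) / 4 * ρ)))) := by
              rw [Real.rpow_add two_pos, Real.rpow_add two_pos, ← two_pow_eq_rpow i, ← hM,
                sub_eq_add_neg, Real.rpow_add two_pos, two_rpow_two]
              ring
          _ ≤ N * (M * (4 * (2 : ℝ) ^ (-((3 : ℝ) / 4 * ρ)))) := by gcongr
      calc (N + (2 : ℝ) ^ (q - r)) * min X Y * (2 : ℝ) ^ (r : ℝ)
          ≤ (N + (2 : ℝ) ^ (q - r)) * Y * (2 : ℝ) ^ (r : ℝ) := by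
            gcongr; exact min_le_right _ _
        _ ≤ (N + (2 : ℝ) ^ (q - r)) * (4 * (2 : ℝ) ^ (κ * (2 * q - 2 * r + ρ))) * (2 : ℝ) ^ (r : ℝ) := by
            gcongr
        _ = 4 * (N * (2 : ℝ) ^ (κ * (2 * q - 2 * r + ρ)) * (2 : ℝ) ^ (r : ℝ) +
              (2 : ℝ) ^ (q - r) * (2 : ℝ) ^ (κ * (2 * q - 2 * r + ρ)) * (2 : ℝ) ^ (r : ℝ)) := by ring
        _ ≤ 4 * (N * (M * (2 * (2 : ℝ) ^ (-((3 : ℝ) / 4 * ρ)))) +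
              N * (M * (4 * (2 : ℝ) ^ (-((3 : ℝ) / 4 * ρ))))) := by gcongr
        _ = M * N * (24 * (2 : ℝ) ^ (-((3 : ℝ) / 4 * ρ))) := by ring
        _ ≤ M * N * (24 * (1 / 2 ^ (ρ / 2))) := by gcongr
        _ = M * N * (24 / 2 ^ (ρ / 2)) := by ring
        _ ≤ M * N * (24 / 2 ^ (ρ / 2) + 2 * 2 ^ (54 * ρ + 3 * t) * η ^ 2) := by
            gcongr; exact le_add_of_nonneg_right (by positivity)
  have hres : (N + (2 : ℝ) ^ (q - r)) * (2 * (min X Y *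
      (2 * ((2 : ℝ) ^ i / 2 ^ (q - r)) + 2 ^ (r - s) * (1 + Real.log ((2 : ℝ) ^ (r - s)))))) ≤
      M * N * (1 + lg) * (48 / 2 ^ (ρ / 2) + 4 * 2 ^ (54 * ρ + 3 * t) * η ^ 2) := by
    calc _ ≤ (N + (2 : ℝ) ^ (q - r)) * (2 * (min X Y * ((2 : ℝ) ^ (r : ℝ) * (1 + lg)))) := by
          gcongr
      _ = 2 * (1 + lg) * ((N + (2 : ℝ) ^ (q - r)) * min X Y * (2 : ℝ) ^ (r : ℝ)) := by ring
      _ ≤ 2 * (1 + lg) * (M * N * (24 / 2 ^ (ρ / 2) + 2 * 2 ^ (54 * ρ + 3 * t) * η ^ 2)) :=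
          mul_le_mul_of_nonneg_left hkey (by positivity)
      _ = M * N * (1 + lg) * (48 / 2 ^ (ρ / 2) + 4 * 2 ^ (54 * ρ + 3 * t) * η ^ 2) := by ring
  -- ### combine
  have hsplit : (N + (2 : ℝ) ^ (q - r)) *
        (lg * (P0 * Pr) + 2 * (min X Y *
            (2 * ((2 : ℝ) ^ i / 2 ^ (q - r)) + 2 ^ (r - s) * (1 + Real.log ((2 : ℝ) ^ (r - s)))))) =
      (N + (2 : ℝ) ^ (q - r)) * (lg * (P0 * Pr)) +
        (N + (2 : ℝ) ^ (q - r)) * (2 * (min X Y *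
            (2 * ((2 : ℝ) ^ i / 2 ^ (q - r)) + 2 ^ (r - s) * (1 + Real.log ((2 : ℝ) ^ (r - s)))))) := by
    ring
  rw [hsplit]
  have hMN0 : 0 ≤ M * N := by positivity
  calc _ ≤ M * N * lg * (32 / 2 ^ ρ) +
        M * N * (1 + lg) * (48 / 2 ^ (ρ / 2) + 4 * 2 ^ (54 * ρ + 3 * t) * η ^ 2) :=
        add_le_add hpart1 hres
    _ ≤ M * N * (1 + lg) * (32 / 2 ^ ρ) +
        M * N * (1 + lg) * (48 / 2 ^ (ρ / 2) + 4 * 2 ^ (54 * ρ + 3 * t) * η ^ 2) := by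
        gcongr; linarith
    _ = 2 ^ i * N * (2 + Real.log ((2 : ℝ) ^ q)) *
        (32 / 2 ^ ρ + 48 / 2 ^ (ρ / 2) + 4 * 2 ^ (54 * ρ + 3 * t) * η ^ 2) := by
        rw [hM, hlg]; ring


/-! ### The algebra of the final combination -/

/-- The bookkeeping inequality behind `boxSum_sq_typeII_zero_bound`: with `M ≤ N`, `L, T ≥ 1`,
`0 < H ≤ L`, `LT ≤ E`, `0 ≤ lg ≤ q`, `q ≥ 1`, `e ≥ 0` and the resonance sum `S` bounded by
`L q M N (2 + lg)(32/L + 48/H + 4Ee)`,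
`M (4N/L) (MN + 2L·M(N/(LT) + 2)(2L+1) + L·N e (2LM + 2MLT(1 + lg)) + S) ≤ (MN)² (q+1)² (324/H + 24/T + 48L/N + 32Ee)`.
[folklore] -/
theorem zero_bound_algebra {M N L Tt E Hh lg e q S : ℝ} (hM : 0 < M) (hMN : M ≤ N) (hL : 1 ≤ L)
    (hTt : 1 ≤ Tt) (hH : 0 < Hh) (hHL : Hh ≤ L) (hLT : L * Tt ≤ E) (hlg0 : 0 ≤ lg) (hlgq : lg ≤ q)
    (hq : 1 ≤ q) (he : 0 ≤ e)
    (hS : S ≤ L * (q * (M * N * (2 + lg) * (32 / L + 48 / Hh + 4 * E * e)))) :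
    M * (4 * N / L) * (M * N + 2 * L * (M * ((N / (L * Tt) + 2) * (2 * L + 1))) +
        (L * (N * e * (2 * L * M + 2 * M * L * Tt * (1 + lg))) + S)) ≤
      (M * N) ^ 2 * (q + 1) ^ 2 * (324 / Hh + 24 / Tt + 48 * L / N + 32 * E * e) := by
  have hN : 0 < N := lt_of_lt_of_le hM hMN
  have hL0 : 0 < L := lt_of_lt_of_le one_pos hL
  have hT0 : 0 < Tt := lt_of_lt_of_le one_pos hTt
  have hE0 : 0 ≤ E := le_trans (by positivity) hLT
  have hLne : L ≠ 0 := hL0.ne'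
  have hTne : Tt ≠ 0 := hT0.ne'
  have hNne : N ≠ 0 := hN.ne'
  have hHne : Hh ≠ 0 := hH.ne'
  set K : ℝ := M * N * (2 + lg) * (32 / L + 48 / Hh + 4 * E * e) with hK
  -- Step 1: the three inner replacements
  have hc : 2 * L * M + 2 * M * L * Tt * (1 + lg) ≤ 2 * M * L * Tt * (2 + lg) := by
    have hLM : 0 ≤ L * M := by positivity
    nlinarith
  have h1 : M * (4 * N / L) * (M * N + 2 * L * (M * ((N / (L * Tt) + 2) * (2 * L + 1))) +
        (L * (N * e * (2 * L * M + 2 * M * L * Tt * (1 + lg))) + S)) ≤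
      M * (4 * N / L) * (M * N + 2 * L * (M * ((N / (L * Tt) + 2) * (3 * L))) +
        (L * (N * e * (2 * M * L * Tt * (2 + lg))) + L * (q * K))) := by
    have h3L : 2 * L + 1 ≤ 3 * L := by linarith
    gcongr
  -- Step 2: expand
  have h2 : M * (4 * N / L) * (M * N + 2 * L * (M * ((N / (L * Tt) + 2) * (3 * L))) +
        (L * (N * e * (2 * M * L * Tt * (2 + lg))) + L * (q * K))) =
      (M * N) ^ 2 * (4 * (1 / L) + 24 * (1 / Tt) + 48 * (L / N) + 8 * (L * Tt * e) * (2 + lg) +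
        4 * q * (2 + lg) * (32 * (1 / L) + 48 * (1 / Hh) + 4 * (E * e))) := by
    rw [hK]
    field_simp
    ring
  -- Step 3: the bracket
  have hP1 : (1 : ℝ) ≤ (q + 1) ^ 2 := by nlinarith
  have hP2 : q + 2 ≤ (q + 1) ^ 2 := by nlinarith
  have hP3 : q * (q + 2) ≤ (q + 1) ^ 2 := by nlinarith
  have hLH : 1 / L ≤ 1 / Hh := one_div_le_one_div_of_le hH hHL
  have hLTe : L * Tt * e ≤ E * e := mul_le_mul_of_nonneg_right hLT he
  have hlg2 : 2 + lg ≤ q + 2 := by linarith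
  have h3 : 4 * (1 / L) + 24 * (1 / Tt) + 48 * (L / N) + 8 * (L * Tt * e) * (2 + lg) +
        4 * q * (2 + lg) * (32 * (1 / L) + 48 * (1 / Hh) + 4 * (E * e)) ≤
      (q + 1) ^ 2 * (324 / Hh + 24 / Tt + 48 * L / N + 32 * E * e) := by
    have hq0 : 0 ≤ q := by linarith
    calc 4 * (1 / L) + 24 * (1 / Tt) + 48 * (L / N) + 8 * (L * Tt * e) * (2 + lg) +
          4 * q * (2 + lg) * (32 * (1 / L) + 48 * (1 / Hh) + 4 * (E * e))
        ≤ 4 * (1 / Hh) + 24 * (1 / Tt) + 48 * (L / N) + 8 * (E * e) * (q + 2) +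
          4 * q * (q + 2) * (32 * (1 / Hh) + 48 * (1 / Hh) + 4 * (E * e)) := by gcongr
      _ = (4 * 1 + 320 * (q * (q + 2))) * (1 / Hh) + 24 * 1 * (1 / Tt) + 48 * 1 * (L / N) +
          (8 * (q + 2) + 16 * (q * (q + 2))) * (E * e) := by ring
      _ ≤ (4 * (q + 1) ^ 2 + 320 * (q + 1) ^ 2) * (1 / Hh) + 24 * (q + 1) ^ 2 * (1 / Tt) +
          48 * (q + 1) ^ 2 * (L / N) + (8 * (q + 1) ^ 2 + 16 * (q + 1) ^ 2) * (E * e) := by gcongr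
      _ = (q + 1) ^ 2 * (324 / Hh + 24 / Tt + 48 * L / N + 24 * E * e) := by ring
      _ ≤ (q + 1) ^ 2 * (324 / Hh + 24 / Tt + 48 * L / N + 32 * E * e) := by gcongr; norm_num
  calc _ ≤ _ := h1
    _ = _ := h2
    _ ≤ (M * N) ^ 2 * ((q + 1) ^ 2 * (324 / Hh + 24 / Tt + 48 * L / N + 32 * E * e)) :=
        mul_le_mul_of_nonneg_left h3 (by positivity)
    _ = (M * N) ^ 2 * (q + 1) ^ 2 * (324 / Hh + 24 / Tt + 48 * L / N + 32 * E * e) := by ring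

/-! ### The `K = 0` box estimate in closed form -/

/-- **The type-II box estimate with the unshifted window, closed form (Bourgain 2013, (2.22)).**
For a digit set `T`, a box `D_i × D_j` with `50ρ ≤ i ≤ j`, a truncation parameter `t ≤ ρ`, and
coefficients `|α|, |β| ≤ 1`: with `q = i + ρ + 1 + t` and `η = 2·2^{-c₂ |T ∩ [0,q)|}`
(`c₂ = walshSupExponent`),
`(boxSum T i j α β)² ≤ 4^{i+j} (q+1)² (324/2^{⌊ρ/2⌋} + 24/2^t + 48·2^ρ/2^j + 32·2^{54ρ+3t} η²)`,
i.e. the printed `X²(L^{-1} + L^{-ε} + L^C 2^{-c|S'|})` (`L = 2^ρ`, `2^{-t} = L^{-ε}`) up to the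
factors `q^{O(1)}`, `L^{O(1)}` made explicit; the term `48·2^ρ/2^j` is the edge effect of the
differencing (`ℓ 2^K < N`). [cite: Bourgain2013MoebiusWalsh, §2 (2.22)] -/
theorem boxSum_sq_typeII_zero_bound (T : Finset ℕ) {i j ρ t : ℕ} (htρ : t ≤ ρ) (hρi : 50 * ρ ≤ i)
    (hij : i ≤ j) (α β : ℕ → ℝ) (hα : ∀ a, |α a| ≤ 1) (hβ : ∀ b, |β b| ≤ 1) :
    (boxSum T i j α β) ^ 2 ≤
      4 ^ (i + j) * (((i + ρ + 1 + t : ℕ) : ℝ) + 1) ^ 2 *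
        (324 / 2 ^ (ρ / 2) + 24 / 2 ^ t + 48 * 2 ^ ρ / 2 ^ j +
          32 * 2 ^ (54 * ρ + 3 * t) *
            (2 * (2 : ℝ) ^ (-(walshSupExponent * ((T.filter (fun x => x < i + ρ + 1 + t)).card : ℝ)))) ^ 2) := by
  have hρj : ρ ≤ j := by omega
  have hmain := boxSum_sq_typeII_zero_le T (i := i) t hρj α β hα hβ
  -- the digit count of the truncated set
  have hcard : ((T.filter fun x => 0 ≤ x ∧ x < (i + ρ + 1) + t).attachFin
      (lt_of_mem_filter_window T ((i + ρ + 1) + t))).card =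
      (T.filter (fun x => x < i + ρ + 1 + t)).card := by
    rw [Finset.card_attachFin]
    congr 1
    exact Finset.filter_congr fun x _ => by simp
  have hNn : (((2 ^ (j + 1) : ℕ) : ℝ) - ((2 ^ j : ℕ) : ℝ)) = (2 : ℝ) ^ j := by
    push_cast; ring
  have hLn : ((2 ^ ρ : ℕ) : ℝ) = (2 : ℝ) ^ ρ := by push_cast; ring
  rw [hcard, hNn, hLn] at hmain
  refine hmain.trans ?_
  set q := i + ρ + 1 + t with hq
  set η : ℝ := 2 * (2 : ℝ) ^ (-(walshSupExponent * ((T.filter (fun x => x < q)).card : ℝ))) with hη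
  have hNM : (2 : ℝ) ^ i ≤ (2 : ℝ) ^ j := pow_le_pow_right₀ one_le_two hij
  -- the double sum, summand by summand
  have hsum := Finset.sum_le_sum (s := Ico 1 (2 ^ ρ)) fun h hh =>
    Finset.sum_le_sum (s := range q) fun r hr =>
      zero_summand_le (s := h.factorization 2) hq (Finset.mem_range.1 hr)
        (factorization_two_lt_of_lt (by have := (Finset.mem_Ico.1 hh).1; omega) (Finset.mem_Ico.1 hh).2)
        htρ hρi hNM η
  set K : ℝ := (2 : ℝ) ^ i * (2 : ℝ) ^ j * (2 + Real.log ((2 : ℝ) ^ q)) *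
    (32 / 2 ^ ρ + 48 / 2 ^ (ρ / 2) + 4 * 2 ^ (54 * ρ + 3 * t) * η ^ 2) with hK
  have hlog0 : 0 ≤ Real.log ((2 : ℝ) ^ q) := Real.log_nonneg (one_le_pow₀ one_le_two)
  have hK0 : 0 ≤ K := by rw [hK]; positivity
  have hbc : ∑ h ∈ Ico 1 (2 ^ ρ), ∑ r ∈ range q, K ≤ (2 : ℝ) ^ ρ * ((q : ℝ) * K) := by
    rw [Finset.sum_const, Nat.card_Ico, Finset.sum_const, Finset.card_range, nsmul_eq_mul,
      nsmul_eq_mul]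
    have h1 : ((2 ^ ρ - 1 : ℕ) : ℝ) ≤ (2 : ℝ) ^ ρ := by
      have : ((2 ^ ρ - 1 : ℕ) : ℝ) ≤ ((2 ^ ρ : ℕ) : ℝ) := by exact_mod_cast Nat.sub_le _ _
      rwa [Nat.cast_pow, Nat.cast_ofNat] at this
    exact mul_le_mul_of_nonneg_right h1 (by positivity)
  have hS := hsum.trans hbc
  -- normalise the powers and apply the algebra
  have hC : (2 : ℝ) ^ q * (1 + Real.log ((2 : ℝ) ^ q)) =
      2 * (2 : ℝ) ^ i * 2 ^ ρ * 2 ^ t * (1 + Real.log ((2 : ℝ) ^ q)) := by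
    rw [hq]; ring
  have hlogq : Real.log ((2 : ℝ) ^ q) ≤ (q : ℝ) := by
    rw [Real.log_pow]
    have h2 : Real.log 2 ≤ 1 := by have := Real.log_two_lt_d9; linarith
    calc (q : ℝ) * Real.log 2 ≤ q * 1 := by gcongr
      _ = q := mul_one _
  have h4 : (4 : ℝ) ^ (i + j) = ((2 : ℝ) ^ i * (2 : ℝ) ^ j) ^ 2 := by
    rw [← pow_add, ← pow_mul, show (4 : ℝ) = 2 ^ 2 by norm_num, ← pow_mul, mul_comm]
  rw [show (2 : ℝ) ^ (ρ + t) = 2 ^ ρ * 2 ^ t from pow_add _ _ _,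
    show (2 : ℝ) ^ (ρ + 1) = 2 * 2 ^ ρ by ring, h4, hC]
  have hq1 : (1 : ℝ) ≤ q := by rw [hq]; exact_mod_cast (show 1 ≤ i + ρ + 1 + t by omega)
  have hHL : (2 : ℝ) ^ (ρ / 2) ≤ 2 ^ ρ := pow_le_pow_right₀ one_le_two (Nat.div_le_self ρ 2)
  have hLT : (2 : ℝ) ^ ρ * 2 ^ t ≤ 2 ^ (54 * ρ + 3 * t) := by
    rw [← pow_add]; exact pow_le_pow_right₀ one_le_two (by omega)
  exact zero_bound_algebra (by positivity) hNM (one_le_pow₀ one_le_two) (one_le_pow₀ one_le_two)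
    (by positivity) hHL hLT hlog0 hlogq hq1 (sq_nonneg η) hS

/-- **The `K = 0` box estimate, absolute-value form**: under the hypotheses of
`boxSum_sq_typeII_zero_bound`, `|boxSum T i j α β| ≤ 2^{i+j} (q+1) B` for any `B ≥ 0` with
`324/2^{⌊ρ/2⌋} + 24/2^t + 48·2^ρ/2^j + 32·2^{54ρ+3t} η² ≤ B²`.
[cite: Bourgain2013MoebiusWalsh, §2 (2.22), (2.29)] -/
theorem abs_boxSum_typeII_zero_bound (T : Finset ℕ) {i j ρ t : ℕ} (htρ : t ≤ ρ) (hρi : 50 * ρ ≤ i)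
    (hij : i ≤ j) (α β : ℕ → ℝ) (hα : ∀ a, |α a| ≤ 1) (hβ : ∀ b, |β b| ≤ 1) {B : ℝ} (hB : 0 ≤ B)
    (hbound : 324 / 2 ^ (ρ / 2) + 24 / 2 ^ t + 48 * 2 ^ ρ / 2 ^ j +
      32 * 2 ^ (54 * ρ + 3 * t) *
        (2 * (2 : ℝ) ^ (-(walshSupExponent * ((T.filter (fun x => x < i + ρ + 1 + t)).card : ℝ)))) ^ 2 ≤
      B ^ 2) :
    |boxSum T i j α β| ≤ 2 ^ (i + j) * (((i + ρ + 1 + t : ℕ) : ℝ) + 1) * B := by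
  have h := boxSum_sq_typeII_zero_bound T htρ hρi hij α β hα hβ
  have h4 : (4 : ℝ) ^ (i + j) = ((2 : ℝ) ^ (i + j)) ^ 2 := by
    rw [← pow_mul, show (4 : ℝ) = 2 ^ 2 by norm_num, ← pow_mul, mul_comm]
  have hsq : ((2 : ℝ) ^ (i + j) * (((i + ρ + 1 + t : ℕ) : ℝ) + 1) * B) ^ 2 =
      4 ^ (i + j) * (((i + ρ + 1 + t : ℕ) : ℝ) + 1) ^ 2 * B ^ 2 := by
    rw [h4]; ring
  have h2 : (boxSum T i j α β) ^ 2 ≤ (2 ^ (i + j) * (((i + ρ + 1 + t : ℕ) : ℝ) + 1) * B) ^ 2 := by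
    refine h.trans ?_
    rw [hsq]
    exact mul_le_mul_of_nonneg_left hbound (by positivity)
  exact abs_le_of_sq_le_sq h2 (by positivity)

end Literature.NumberTheory.LFunctions.MoebiusWalshTypeII
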